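import Summits.CriticalPhenomena.PercolationContinuityZ3.Theorems.PercNearOneGluingNoHeavyPcintMemAutomatonStates
import HarnessLib

/-!
# CriticalPhenomena/PercolationContinuityZ3 — Theorems/PercNearOneGluingNoHeavyPcintMemAutomatonCensus.lean: the states of the memory automaton ARE the self-avoiding walks `ω` with `|ω| + ‖ω‖₁ ≤ τ`

Lane prim-pcint, STRUCTURE rule, law **C3** (class-count / cost law), in its EXACT form found by prim-pcint-2 gen 13
(gen13/README §3, c3check/): the dangerous-set classes of the memory-`τ` automaton are in bijection, modulo the point group `B_d`,
with the self-avoiding walks `ω` of length `m ≤ τ − 1` whose end-to-end `ℓ¹`-distance satisfies `m + ‖ω(m) − ω(0)‖₁ ≤ τ`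
(verified to the unit, every histogram bin, at `d = 2`, `τ = 20, 22` — 1 973 511 and 11 778 632 classes — and `d = 3`, `τ = 12, 14` —
46 562 and 759 774 classes — against direct SAW enumeration + orbit counting).  This file proves the word-level core of that identity
(no symmetry quotient, which the tree does not have):

* `mem_danger_mono_age` — KEPT AGES FORM AN INITIAL SEGMENT: if the site of age `j + 1` is dangerous so is the site of age `j`
  (adjacent sites, thresholds differing by one);
* `mem_danger_of_near` — a word `ω` of length `m` with `‖ω(m)‖₁ ≤ τ − m` keeps EVERY age `1 ≤ j ≤ m` (distance `≤ (m − j) + (τ − m)`);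
* `near_of_mem_danger`, `allKept_iff_near` — conversely age `m` kept forces `‖ω(m)‖₁ ≤ τ − m`; so 'all `m` ages kept' ⇔ 'near'
  (`m + ‖ω‖₁ ≤ τ`), generalising `full_iff_closing` (`m = τ − 1`);
* `danger_injOn_near` — `ω ↦ danger τ ω` is injective on the near words of length `m` (generalising `danger_injOn_closing`);
* `card_near_le_card_image_danger`, `card_allKept_eq_card_near` — **the states reached after `m ≤ τ − 1` letters that keep all `m`
  ages are in bijection with the self-avoiding words `ω` of length `m` with `m + ‖ω(m)‖₁ ≤ τ`**; in particular there are at least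
  that many states.

With `danger_eq_danger_suffix` (`…States`) every reachable state is such an 'all-kept' state of its own last `m` letters
(`m` = its maximal age, by `mem_danger_mono_age`), which gives the identity `#states = Σ_{m ≤ τ−1} #{ω ∈ SAW_m : m + ‖ω‖₁ ≤ τ}`;
the bookkeeping of that union over `m` (disjointness by maximal age) is left to the census note, the two directions being the
theorems here.  Consequence for the lane (C3): `N_d(τ)·|B_d| ≈ Σ_m Σ_{‖x‖₁ ≤ τ−m} c_m(x) ≍ μ^τ τ^{α−2}` and the price of a memory
rung `→ μ(ℤ^d)²`.  All PROVED; nothing here is used by a certified `p_c` cell.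
Written by prim-pcint-2 gen 13 (prover-prim-pcint-2-g13-0), 2026-08-23.
-/

noncomputable section

open Literature.Probability.LatticeModels Literature.Probability.Percolation
open Summit.CriticalPhenomena.PercolationContinuityZ3.Theorems.Pcint
  (IsMem l1 l1_neg l1_add_le l1_stepVec danger mem_danger)

namespace Summit.CriticalPhenomena.PercolationContinuityZ3.Theorems.Pcint.MemoryTail

variable {d : ℕ}

/-! ### Kept ages form an initial segment -/

/-- **Initial segment**: if the site of age `j + 1` (`j ≥ 1`) is in the dangerous set of `w`, so is the site of age `j` — it is a
lattice neighbour (one step later along the word) and its threshold `τ − j` is one larger. [folklore] -/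
theorem mem_danger_mono_age {τ n : ℕ} (w : Fin n → Fin d × Bool) {r : Site d} {j : ℕ} (hj : 1 ≤ j)
    (h : (r, j + 1) ∈ danger τ w) : (wordPos w (n - j) - wordPos w n, j) ∈ danger τ w := by
  rw [mem_danger] at h ⊢
  obtain ⟨-, h2, h3, hr, hl⟩ := h
  simp only at h2 h3 hr hl
  refine ⟨hj, by omega, by omega, rfl, ?_⟩
  have hstep : wordPos w (n - j) = wordPos w (n - (j + 1)) + stepVec (w ⟨n - (j + 1), by omega⟩) := by
    rw [show n - j = n - (j + 1) + 1 by omega]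
    exact wordPos_succ w (by omega)
  have : wordPos w (n - j) - wordPos w n = r + stepVec (w ⟨n - (j + 1), by omega⟩) := by
    rw [hstep, hr]; abel
  rw [this]
  calc l1 (r + stepVec (w ⟨n - (j + 1), by omega⟩)) ≤ l1 r + l1 (stepVec (w ⟨n - (j + 1), by omega⟩)) := l1_add_le _ _
    _ = l1 r + 1 := by rw [l1_stepVec]
    _ ≤ τ - j := by omega

/-! ### Near words keep every age -/

/-- A word `ω` of length `m ≤ τ` with `‖ω(m)‖₁ ≤ τ − m` ('near': `m + ‖ω‖₁ ≤ τ`) keeps the site of every age `1 ≤ j ≤ m` (also `j ≤ τ − 1`):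
its distance from the tip is at most `(m − j) + (τ − m) = τ − j`. [folklore] -/
theorem mem_danger_of_near {τ m : ℕ} (hm : m ≤ τ) {w : Fin m → Fin d × Bool} (hnear : l1 (wordPos w m) ≤ τ - m) {j : ℕ}
    (hj1 : 1 ≤ j) (hjm : j ≤ m) (hjτ : j ≤ τ - 1) : (wordPos w (m - j) - wordPos w m, j) ∈ danger τ w := by
  rw [mem_danger]
  refine ⟨hj1, hjτ, hjm, rfl, ?_⟩
  calc l1 (wordPos w (m - j) - wordPos w m) ≤ l1 (wordPos w (m - j)) + l1 (wordPos w m) := l1_sub_le _ _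
    _ ≤ (m - j) + (τ - m) := Nat.add_le_add (l1_wordPos_le w _ (by omega)) hnear
    _ ≤ τ - j := by omega

/-- Conversely, if the site of age `m` (the starting point) of a word of length `m` is dangerous then `‖ω(m)‖₁ ≤ τ − m`. [folklore] -/
theorem near_of_mem_danger {τ m : ℕ} {w : Fin m → Fin d × Bool} {r : Site d} (h : (r, m) ∈ danger τ w) :
    l1 (wordPos w m) ≤ τ - m := by
  rw [mem_danger] at h
  obtain ⟨-, -, -, hr, hl⟩ := h
  simp only [Nat.sub_self, wordPos_zero, zero_sub] at hr hl
  rwa [hr, l1_neg] at hl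

/-- **All ages kept ⇔ near** (`1 ≤ m ≤ τ − 1`): a word of length `m` keeps its starting point (equivalently, by
`mem_danger_mono_age`, all its sites) iff `m + ‖ω(m)‖₁ ≤ τ`.  The case `m = τ − 1` is `full_iff_closing`. [folklore] -/
theorem allKept_iff_near {τ m : ℕ} (hm1 : 1 ≤ m) (hmτ : m ≤ τ - 1) (w : Fin m → Fin d × Bool) :
    (∃ r : Site d, (r, m) ∈ danger τ w) ↔ l1 (wordPos w m) ≤ τ - m := by
  constructor
  · rintro ⟨r, hr⟩
    exact near_of_mem_danger hr
  · intro h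
    exact ⟨_, mem_danger_of_near (by omega) h hm1 le_rfl hmτ⟩

/-! ### Injectivity on near words and the census identity -/

/-- **Injectivity on near words**: two words of length `m ≤ τ − 1` with `‖ω(m)‖₁ ≤ τ − m` and the same dangerous set are equal
(age `m` recovers the endpoint, then every position, then every letter). [folklore] -/
theorem danger_injOn_near (τ m : ℕ) (hmτ : m ≤ τ - 1) :
    Set.InjOn (danger (d := d) τ) {w : Fin m → Fin d × Bool | l1 (wordPos w m) ≤ τ - m} := by
  intro w hw w' hw' h
  simp only [Set.mem_setOf_eq] at hw hw'
  have key : ∀ j, 1 ≤ j → j ≤ m → wordPos w (m - j) - wordPos w m = wordPos w' (m - j) - wordPos w' m := by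
    intro j hj1 hj
    have hmem := mem_danger_of_near (by omega) hw hj1 hj (by omega)
    rw [h, mem_danger] at hmem
    exact hmem.2.2.2.1
  have hpos : ∀ k, k ≤ m → wordPos w k = wordPos w' k := by
    intro k hk
    rcases Nat.eq_zero_or_pos m with h0 | hpos
    · have : k = 0 := by omega
      subst this; simp
    have hE : wordPos w m = wordPos w' m := by
      have := key m (by omega) le_rfl
      simpa using this
    rcases Nat.eq_or_lt_of_le hk with rfl | hlt
    · exact hE
    have := key (m - k) (by omega) (by omega)
    rw [show m - (m - k) = k by omega, hE] at this
    exact sub_left_injective this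
  funext ⟨i, hi⟩
  have h0 := hpos i hi.le
  have h1 := hpos (i + 1) (by omega)
  rw [wordPos_succ w hi, wordPos_succ w' hi, h0] at h1
  exact GMStep.stepVec_injective d (add_left_cancel h1)

/-- **States after `m` letters ≥ near self-avoiding words of length `m`** (`m ≤ τ − 1`). [folklore] -/
theorem card_near_le_card_image_danger (d τ m : ℕ) (hmτ : m ≤ τ - 1) :
    ((sawWords d m).filter fun w => l1 (wordPos w m) ≤ τ - m).card ≤ ((memWords d τ m).image (danger τ)).card := by
  classical
  refine Finset.card_le_card_of_injOn (danger τ) (fun w hw => ?_) ((danger_injOn_near τ m hmτ).mono fun w hw => ?_)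
  · rw [Finset.mem_coe, Finset.mem_filter] at hw
    rw [Finset.mem_coe, Finset.mem_image]
    exact ⟨w, by rw [memWords_eq_sawWords (by omega : m ≤ τ)]; exact hw.1, rfl⟩
  · rw [Finset.mem_coe, Finset.mem_filter] at hw
    exact hw.2

open Classical in
/-- **Census identity, per length** (`1 ≤ m ≤ τ − 1`): the states reached after `m` letters that still contain a site of age `m`
(so, by `mem_danger_mono_age`, of every age `≤ m`) are in bijection with the self-avoiding words `ω` of length `m` with
`m + ‖ω(m)‖₁ ≤ τ`.  Summing over `m` (every reachable state is the all-kept state of its last `m` letters, `m` its maximal age: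
`danger_eq_danger_suffix`) is the lane's identity `#states = #{ω ∈ SAW : |ω| ≤ τ−1, |ω| + ‖ω‖₁ ≤ τ}`. [folklore] -/
theorem card_allKept_eq_card_near {τ m : ℕ} (hm1 : 1 ≤ m) (hmτ : m ≤ τ - 1) (d : ℕ) :
    (((memWords d τ m).image (danger τ)).filter fun S => ∃ r : Site d, (r, m) ∈ S).card =
      ((sawWords d m).filter fun w => l1 (wordPos w m) ≤ τ - m).card := by
  symm
  refine Finset.card_bij (fun w _ => danger τ w) (fun w hw => ?_) (fun w hw w' hw' h => ?_) (fun S hS => ?_)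
  · rw [Finset.mem_filter] at hw ⊢
    refine ⟨Finset.mem_image.2 ⟨w, by rw [memWords_eq_sawWords (by omega : m ≤ τ)]; exact hw.1, rfl⟩, ?_⟩
    exact (allKept_iff_near hm1 hmτ w).2 hw.2
  · rw [Finset.mem_filter] at hw hw'
    exact danger_injOn_near τ m hmτ hw.2 hw'.2 h
  · rw [Finset.mem_filter, Finset.mem_image] at hS
    obtain ⟨⟨w, hw, rfl⟩, hkept⟩ := hS
    refine ⟨w, ?_, rfl⟩
    rw [Finset.mem_filter]
    rw [memWords_eq_sawWords (by omega : m ≤ τ)] at hw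
    exact ⟨hw, (allKept_iff_near hm1 hmτ w).1 hkept⟩

end Summit.CriticalPhenomena.PercolationContinuityZ3.Theorems.Pcint.MemoryTail
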